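import Mathlib
import Literature.Computability.Complexity.RandomKSatUniformlyPos
import Summits.PneNP.PneNP.Theses.OverlapGapAlgebra

/-!
# PneNP / OverlapGapAlgebra — `PositiveSatProbability` (item stmt-PneNP-2464)

The support item `PositiveSatProbability` of route `route-PneNP-OverlapGapAlgebra`:
there is `k₀` such that for every `k ≥ k₀` random `k`-SAT `F_k(n, ⌊α_k n⌋)` at the window density
`α_k = 5 · 2^k log k / k` (with-replacement literal model, literal arrays
`Φ : Fin m → Fin k → Fin n × Bool`) is satisfiable with uniformly positive probability
(`∃ ε > 0`, for all large `n`, `#{Φ satisfiable} ≥ ε · #univ`).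

This is Achlioptas–Peres 2004 (J. AMS 17; arXiv:cs/0305009), the theorem behind their Theorem 2
*before* Friedgut's sharp-threshold theorem is invoked, which the tree holds UNCONDITIONALLY as
`Literature.Computability.Complexity.achlioptasPeres2004_uniformlyPos`
(`RandomKSatUniformlyPos.lean`): for `k ≥ 1024` and every
`r < ρ_k = (2^k log 2 - (k+1) log 2 / 2 - 1) - 2 (15k²/2^k + (k+3)/2^k + 32k²(50/81)^k + 32k(5/9)^k)`
there is `c > 0` with `Pr[F_k(n, ⌊r n⌋) satisfiable] ≥ c` eventually, the probability being the
counting ratio `litArraySatProb k n m` over exactly the route's literal-array type.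

What is proved here is therefore the elementary comparison `α_k < ρ_k` for `k ≥ 1024`
(`positiveSatProbability_window_density_lt_rho`: `log k ≤ k/10` for `k ≥ 400` and
`1024 k² ≤ k³ ≤ 2^k` for `k ≥ 1024` make `α_k ≤ 2^k / 2`, while `ρ_k ≥ 2^k log 2 - 64k² - 65k - 6` and `log 2 > 0.69`), and the
identification of the route's counting ratio with `litArraySatProb` (definitional up to the
decidability instance of the filter).

Prover prover-pitem-stmt-PneNP-2464-0, 2026-08-16.
-/

-- `Summit.PneNP.PneNP.…` is the tree's mandated namespace (summit = sub-problem name).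
set_option linter.dupNamespace false

namespace Summit.PneNP.PneNP.Theorems

open Real

/-- `log x ≤ x / 10` for real `x ≥ 400` (from `1 + y ≤ e^y` at `y = x/20`). [folklore] -/
theorem positiveSatProbability_log_le_div_ten {x : ℝ} (hx : 400 ≤ x) : Real.log x ≤ x / 10 := by
  have hxpos : 0 < x := by linarith
  rw [Real.log_le_iff_le_exp hxpos]
  have h1 : 1 + x / 20 ≤ Real.exp (x / 20) := by linarith [Real.add_one_le_exp (x / 20)]
  have h2 : Real.exp (x / 10) = Real.exp (x / 20) ^ 2 := by
    rw [sq, ← Real.exp_add]; ring_nf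
  rw [h2]
  have h3 : (0 : ℝ) ≤ 1 + x / 20 := by linarith
  have h4 : 0 ≤ x * (x - 400) := mul_nonneg hxpos.le (by linarith)
  calc x ≤ (1 + x / 20) ^ 2 := by nlinarith [h4]
    _ ≤ Real.exp (x / 20) ^ 2 := pow_le_pow_left₀ h3 h1 2

/-- `1024 k² ≤ 2^k` (in `ℝ`) for every natural `k ≥ 1024`: `k³ = e^{3 log k} ≤ e^{3k/10} ≤ e^{k log 2}
= 2^k` by `positiveSatProbability_log_le_div_ten` and `log 2 > 0.69`, and `1024 k² ≤ k³`. [folklore] -/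
theorem positiveSatProbability_sq_le_two_pow {k : ℕ} (hk : 1024 ≤ k) :
    1024 * (k : ℝ) ^ 2 ≤ 2 ^ k := by
  have hkr : (1024 : ℝ) ≤ k := by exact_mod_cast hk
  have hkpos : (0 : ℝ) < k := by linarith
  have hlog : Real.log k ≤ k / 10 := positiveSatProbability_log_le_div_ten (by linarith)
  have hlog2 : (0.6931471803 : ℝ) < Real.log 2 := Real.log_two_gt_d9
  have hcube : (k : ℝ) ^ 3 ≤ 2 ^ k := by
    have e1 : (k : ℝ) ^ 3 = Real.exp (3 * Real.log k) := by
      rw [show (3 : ℝ) * Real.log k = ((3 : ℕ) : ℝ) * Real.log k by norm_num, Real.exp_nat_mul,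
        Real.exp_log hkpos]
    have e2 : (2 : ℝ) ^ k = Real.exp (k * Real.log 2) := by
      rw [Real.exp_nat_mul, Real.exp_log two_pos]
    rw [e1, e2, Real.exp_le_exp]
    have hkl : 0.6931471803 * (k : ℝ) ≤ k * Real.log 2 := by nlinarith
    linarith
  have hk2 : 1024 * (k : ℝ) ^ 2 ≤ (k : ℝ) ^ 3 := by nlinarith
  exact hk2.trans hcube

/-- The window density `α_k = 5 · 2^k log k / k` lies below the Achlioptas–Peres radius
`ρ_k = (2^k log 2 - (k+1) log 2/2 - 1) - 2δ_k` of `achlioptasPeres2004_uniformlyPos` for every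
`k ≥ 1024`. [folklore] -/
theorem positiveSatProbability_window_density_lt_rho {k : ℕ} (hk : 1024 ≤ k) :
    5 * 2 ^ k * Real.log k / k < (2 ^ k * Real.log 2 - ((k : ℝ) + 1) * Real.log 2 / 2 - 1) -
      2 * (15 * (k : ℝ) ^ 2 / 2 ^ k + (((k : ℝ) + 3) / 2 ^ k + 32 * (k : ℝ) ^ 2 * (50 / 81) ^ k +
        32 * (k : ℝ) * (5 / 9) ^ k)) := by
  have hkr : (1024 : ℝ) ≤ k := by exact_mod_cast hk
  have hkpos : (0 : ℝ) < k := by linarith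
  have hP : 1024 * (k : ℝ) ^ 2 ≤ 2 ^ k := positiveSatProbability_sq_le_two_pow hk
  have hlog : Real.log k ≤ k / 10 := positiveSatProbability_log_le_div_ten (by linarith)
  have hlog2 : (0.6931471803 : ℝ) < Real.log 2 := Real.log_two_gt_d9
  have hlog2' : Real.log 2 < 0.6931471808 := Real.log_two_lt_d9
  have h2kpos : (0 : ℝ) < 2 ^ k := by positivity
  have hA : (50 / 81 : ℝ) ^ k ≤ 1 := pow_le_one₀ (by norm_num) (by norm_num)
  have hB : (5 / 9 : ℝ) ^ k ≤ 1 := pow_le_one₀ (by norm_num) (by norm_num)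
  have hA0 : (0 : ℝ) ≤ (50 / 81 : ℝ) ^ k := by positivity
  have hB0 : (0 : ℝ) ≤ (5 / 9 : ℝ) ^ k := by positivity
  -- `k² ≥ 1024 k`
  have hk2 : 1024 * (k : ℝ) ≤ (k : ℝ) ^ 2 := by nlinarith
  -- the left-hand side is at most `2^k / 2`
  have hL : 5 * 2 ^ k * Real.log k / k ≤ 2 ^ k / 2 := by
    rw [div_le_iff₀ hkpos]
    have : 5 * 2 ^ k * Real.log k ≤ 5 * 2 ^ k * (k / 10) :=
      mul_le_mul_of_nonneg_left hlog (by positivity)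
    linarith
  -- the four small terms
  have hT1 : 15 * (k : ℝ) ^ 2 / 2 ^ k ≤ 1 := by
    rw [div_le_one h2kpos]; nlinarith
  have hT2 : ((k : ℝ) + 3) / 2 ^ k ≤ 1 := by
    rw [div_le_one h2kpos]; linarith
  have hT3 : 32 * (k : ℝ) ^ 2 * (50 / 81) ^ k ≤ 32 * (k : ℝ) ^ 2 := by
    have : 32 * (k : ℝ) ^ 2 * (50 / 81) ^ k ≤ 32 * (k : ℝ) ^ 2 * 1 :=
      mul_le_mul_of_nonneg_left hA (by positivity)
    linarith
  have hT4 : 32 * (k : ℝ) * (5 / 9) ^ k ≤ 32 * (k : ℝ) := by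
    have : 32 * (k : ℝ) * (5 / 9) ^ k ≤ 32 * (k : ℝ) * 1 :=
      mul_le_mul_of_nonneg_left hB (by positivity)
    linarith
  -- the two products with `log 2`
  have hM : 0.6931471803 * (2 : ℝ) ^ k ≤ 2 ^ k * Real.log 2 := by nlinarith
  have hN : ((k : ℝ) + 1) * Real.log 2 ≤ 0.6931471808 * ((k : ℝ) + 1) := by nlinarith
  linarith

/-- **Item stmt-PneNP-2464 (`PositiveSatProbability`), proved.** With `k₀ = 1024`: for every
`k ≥ 1024` there is `ε > 0` such that for all large `n`, with `m = ⌊5 · 2^k log k / k · n⌋₊`, at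
least an `ε`-fraction of the literal arrays `Φ : Fin m → Fin k → Fin n × Bool` are satisfiable.
Immediate from the unconditional tree theorem
`Literature.Computability.Complexity.achlioptasPeres2004_uniformlyPos` (Achlioptas–Peres 2004,
the second-moment theorem behind their Thm. 2) at `r = 5 · 2^k log k / k < ρ_k`
(`positiveSatProbability_window_density_lt_rho`). [cite: AchlioptasPeres2004, §7 p. 16 with Lemma 1 p. 3] -/
theorem positiveSatProbability_proof :
    Summit.PneNP.PneNP.Theses.OverlapGapAlgebra.PositiveSatProbability := by
  unfold Summit.PneNP.PneNP.Theses.OverlapGapAlgebra.PositiveSatProbability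
  refine ⟨1024, fun k hk => ?_⟩
  obtain ⟨c, hc, hev⟩ :=
    Literature.Computability.Complexity.achlioptasPeres2004_uniformlyPos
      (r := 5 * 2 ^ k * Real.log k / k) hk (positiveSatProbability_window_density_lt_rho hk)
  refine ⟨c, hc, ?_⟩
  filter_upwards [hev] with n hn m hm
  subst hm
  simpa [Literature.Computability.Complexity.litArraySatProb,
    Literature.Computability.Complexity.LitArraySat] using hn

end Summit.PneNP.PneNP.Theorems
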